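import Summits.HodgeConjecture.CorCM.Model.RosatiDualForm
import Mathlib.LinearAlgebra.Dual.Lemmas
import Mathlib.LinearAlgebra.TensorProduct.Basis
import HarnessLib

/-!
# COR-CM model layer, row M22 input R2 (part B, algebra): from the dual form to the TENSOR form of the Rosati
# identity

Cell `pub-hodgecm2` (COR-CM = Hodge ladder stage 2), binder row M22 `Fact_algDuality`, input **R2**, seat b26.  HONEST
FRAMING: pure linear algebra; nothing about algebraic cycles and no case of the Hodge conjecture.

The kernel K-a of row M22 (model-1, INBOX 2026-08-20T18:52:18Z / 19:10:29Z) consumes the Rosati identity as a TENSOR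
identity `Σ_a T(b_a) ⊗ y_a = Σ_a b_a ⊗ T'(y_a)` in `H¹ ⊗ H¹` for a basis `b` and the `θ`-polar family `y`
(`Σ_a b_a ⊗ y_a = θ₁₁`, the `(1,1)`-Künneth component of `m^*θ`), while R2 (files `RosatiDualForm`,
`RosatiThetaProd4`, `RosatiThetaProduct`) delivers the DUAL form `B_ω(φ ∘ T, ψ) = B_ω(φ, ψ ∘ T')`,
`B_ω(φ, ψ) = exteriorPower.alternatingMapToDual F V 2 ![φ, ψ] ω`.  This file is the def-free bridge: for ANY tensor
`Θ ∈ V ⊗ V` REPRESENTING `B_ω` — `(φ ⊗ ψ)(Θ) = B_ω(φ, ψ)` for all covectors (`TensorProduct.dualDistrib`), which for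
`ω = x ∧ y` means `Θ = x ⊗ y - y ⊗ x` and in general is the defining property of the polar family — the dual form
implies `(T ⊗ 1) Θ = (1 ⊗ T') Θ`, and in the indexed shape `Σ_a T(b_a) ⊗ y_a = Σ_a b_a ⊗ T'(y_a)`.

* `tensor_eq_of_forall_dualDistrib` — two tensors in `V ⊗ V` with the same `(φ ⊗ ψ)`-evaluations are equal
  (coordinates in the tensor basis are such evaluations);
* `dualDistrib_tmul_map` — `(φ ⊗ ψ)((f ⊗ g) Θ) = ((φ ∘ f) ⊗ (ψ ∘ g))(Θ)`;
* `tensor_rosati_of_altDual` — dual form ⟹ tensor form for a representing tensor;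
* `sum_tmul_rosati_of_altDual` — the same in the indexed shape `Σ_a T(b_a) ⊗ y_a = Σ_a b_a ⊗ T'(y_a)`.

## References
* [LangeBirkenhake1992] H. Lange, Ch. Birkenhake, *Complex Abelian Varieties* (1992), §5.1 (Rosati involution),
  Lemma 1.1.17.
* [Deligne1982HodgeCycles] P. Deligne (notes by J. S. Milne), *Hodge cycles on abelian varieties*, LNM 900 (1982),
  §4 p. 47.
-/

noncomputable section

open TensorProduct

namespace Summit.HodgeConjecture.CorCM.Model

section TensorForm

variable {F : Type*} [Field F] {V : Type*} [AddCommGroup V] [Module F V]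

/-- **Covector pairs separate tensors**: two elements of `V ⊗ V` on which every `φ ⊗ ψ` (`φ, ψ ∈ Vᵛ`) takes the same
value are equal (the coordinates in the tensor basis `βᵢ ⊗ βⱼ` are the evaluations of `βᵛᵢ ⊗ βᵛⱼ`). [folklore] -/
theorem tensor_eq_of_forall_dualDistrib (Θ₁ Θ₂ : V ⊗[F] V)
    (h : ∀ φ ψ : Module.Dual F V,
      TensorProduct.dualDistrib F V V (φ ⊗ₜ ψ) Θ₁ = TensorProduct.dualDistrib F V V (φ ⊗ₜ ψ) Θ₂) :
    Θ₁ = Θ₂ := by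
  let β := Module.Free.chooseBasis F V
  apply (β.tensorProduct β).repr.injective
  ext ⟨i, j⟩
  have key : ∀ Θ : V ⊗[F] V, (β.tensorProduct β).repr Θ (i, j) =
      TensorProduct.dualDistrib F V V (β.coord i ⊗ₜ β.coord j) Θ := by
    intro Θ
    induction Θ using TensorProduct.induction_on with
    | zero => rw [map_zero, map_zero, Finsupp.zero_apply]
    | tmul m n =>
      rw [Module.Basis.tensorProduct_repr_tmul_apply, TensorProduct.dualDistrib_apply, Module.Basis.coord_apply,
        Module.Basis.coord_apply, smul_eq_mul, mul_comm]
    | add x y hx hy => rw [map_add, Finsupp.add_apply, hx, hy, map_add]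
  rw [key, key, h]

/-- `(φ ⊗ ψ)((f ⊗ g) Θ) = ((φ ∘ f) ⊗ (ψ ∘ g))(Θ)`. [folklore] -/
theorem dualDistrib_tmul_map (φ ψ : Module.Dual F V) (f g : V →ₗ[F] V) (Θ : V ⊗[F] V) :
    TensorProduct.dualDistrib F V V (φ ⊗ₜ ψ) (TensorProduct.map f g Θ) =
      TensorProduct.dualDistrib F V V ((φ ∘ₗ f) ⊗ₜ (ψ ∘ₗ g)) Θ := by
  induction Θ using TensorProduct.induction_on with
  | zero => rw [map_zero, map_zero, map_zero]
  | tmul m n =>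
    rw [TensorProduct.map_tmul, TensorProduct.dualDistrib_apply, TensorProduct.dualDistrib_apply,
      LinearMap.comp_apply, LinearMap.comp_apply]
  | add x y hx hy => rw [map_add, map_add, hx, hy, map_add]

/-- **Dual form ⟹ tensor form of the Rosati identity.**  If `Θ ∈ V ⊗ V` represents the alternating dual pairing of
`ω ∈ ⋀²V` (`(φ ⊗ ψ)(Θ) = B_ω(φ, ψ)` for all covectors) and `B_ω(φ ∘ T, ψ) = B_ω(φ, ψ ∘ T')` for all covectors, then
`(T ⊗ 1) Θ = (1 ⊗ T') Θ`. [cite: LangeBirkenhake1992, §5.1] -/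
theorem tensor_rosati_of_altDual (ω : ⋀[F]^2 V) (Θ : V ⊗[F] V)
    (hΘ : ∀ φ ψ : Module.Dual F V, TensorProduct.dualDistrib F V V (φ ⊗ₜ ψ) Θ =
      exteriorPower.alternatingMapToDual F V 2 ![φ, ψ] ω)
    (T T' : V →ₗ[F] V)
    (hros : ∀ φ ψ : Module.Dual F V, exteriorPower.alternatingMapToDual F V 2 ![φ ∘ₗ T, ψ] ω =
      exteriorPower.alternatingMapToDual F V 2 ![φ, ψ ∘ₗ T'] ω) :
    TensorProduct.map T LinearMap.id Θ = TensorProduct.map LinearMap.id T' Θ := by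
  refine tensor_eq_of_forall_dualDistrib _ _ fun φ ψ ↦ ?_
  rw [dualDistrib_tmul_map, dualDistrib_tmul_map, LinearMap.comp_id, LinearMap.comp_id, hΘ, hΘ, hros]

/-- **Tensor form, indexed shape** (the K-a input): if `Σ_a φ(b_a) ψ(y_a) = B_ω(φ, ψ)` for all covectors (the defining
property of the `ω`-polar family `y` of a family `b`) and the dual-form Rosati identity holds for `(T, T')`, then
`Σ_a T(b_a) ⊗ y_a = Σ_a b_a ⊗ T'(y_a)` in `V ⊗ V`. [cite: LangeBirkenhake1992, §5.1 and Lemma 1.1.17] -/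
theorem sum_tmul_rosati_of_altDual {ι : Type*} [Fintype ι] (ω : ⋀[F]^2 V) (b y : ι → V)
    (hby : ∀ φ ψ : Module.Dual F V, ∑ a, φ (b a) * ψ (y a) = exteriorPower.alternatingMapToDual F V 2 ![φ, ψ] ω)
    (T T' : V →ₗ[F] V)
    (hros : ∀ φ ψ : Module.Dual F V, exteriorPower.alternatingMapToDual F V 2 ![φ ∘ₗ T, ψ] ω =
      exteriorPower.alternatingMapToDual F V 2 ![φ, ψ ∘ₗ T'] ω) :
    ∑ a, T (b a) ⊗ₜ[F] y a = ∑ a, b a ⊗ₜ[F] T' (y a) := by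
  have hΘ : ∀ φ ψ : Module.Dual F V, TensorProduct.dualDistrib F V V (φ ⊗ₜ ψ) (∑ a, b a ⊗ₜ[F] y a) =
      exteriorPower.alternatingMapToDual F V 2 ![φ, ψ] ω := by
    intro φ ψ
    rw [map_sum, ← hby φ ψ]
    exact Finset.sum_congr rfl fun a _ ↦ TensorProduct.dualDistrib_apply φ ψ (b a) (y a)
  have h := tensor_rosati_of_altDual ω _ hΘ T T' hros
  rw [map_sum, map_sum] at h
  simpa only [TensorProduct.map_tmul, LinearMap.id_coe, id_eq] using h

end TensorForm

end Summit.HodgeConjecture.CorCM.Model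

end
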